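import Summits.ResolutionOfSingularities.ResolutionOfSingularities.Theorems.WildConesCampaignW46HypersurfacesCharTwoHilbert

/-!
# [OURS · L1 W4.6, rung (ii) at p = 2, EVERY dimension n] THE TANGENT CONE AT `e = 2` — the two
# leaves of the descent: NO TANGENT CUBIC (`h₂ = 3`) makes the strict transform singular along the
# exceptional divisor; THREE DISTINCT TANGENTS (`h₂ = 1`) force a hyperbolic pair in the strict
# transform (hypersurface double points `z² = a(u₁,…,uₙ)`, every field of characteristic 2)

HONEST FRAMING. Everything here is OURS: lemmas about route WildCones' own TYPED point-blow-up
dynamics in its formal dress (`Theorems/WildConesClassicalRegimesStubMuDropCharTwoOrdP*.lean`: the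
blow-up relation `X_i² G = a∘Φ_{i,τ}`, `Φ_{i,τ} : X_i ↦ X_i, X_s ↦ X_i (X_s + τ_s)`, between the
cleaned series `a` of a double point and the series `G` of its successor) and this seat's invariant
`jetThreeColength` (`…HypersurfacesCharTwoHilbertDefs.lean`, `…Hilbert.lean`). Nothing here is a
statement of H. Hironaka's manuscript [Hironaka2017] and nothing of it is used; no FACT-LIST premise.
AI review is weaker than expert review. Cell res-hironaka (LADDER-RESOLUTION rung L, D-0089), slot
W4.6, seat res-L1-s46-pv-4 (gen 4); host route `WildCones`, crux `ClassicalRegimes`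
(stmt-ResolutionOfSingularities-16884, proved); `--supports` that item as a helper.

WHAT IS HERE (second file of the gen-4 package «the case `e = 2`»; the induction over the hyperbolic
pairs and the state-level theorems are in `…HypersurfacesCharTwoTangentCone.lean`):

* `not_finite_strict_of_pderiv_mem_cube` — ANY number `n ≥ 2` of variables: if every partial of `a`
  lies in `𝔪³` then every partial of `G` is divisible by `X_i`, so the Milnor algebra of `G` is not
  finite (the leaf `h₂ = 3`: after the residual descent, `e = 2` and `h₂ = 3` mean exactly «two
  variables, both partials in `𝔪³`», `jetThreeColength_eq_six_iff`).
* two variables `{i, j}`: exponents (`finTwo_eq_single_add`, `finTwo_degree`), the quadratic part of a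
  series in `𝔪²` (`sub_quadPart_mem_cube`), and THE `X_i²`-COEFFICIENT AFTER THE BLOW-UP
  `coeff_sq_subst_blowFam`: `[X_i²](h∘Φ_{i,τ}) = [X_i²]h + t[X_iX_j]h + t²[X_j²]h`, `t = τ j`.
* `coeff_pair_strict_ne_zero_of_jetThreeColength_le_four` — the leaf `h₂ = 1`: for `a` without
  `X_iX_j`-term and `G` without linear terms, `jetThreeColength a ≤ 4` forces `[X_iX_j] G ≠ 0`
  (with `(∂ᵢa)₂ = αX_i² + γX_j²`, `(∂ⱼa)₂ = βX_i² + δX_j²`: `[X_i]G = 0` and `[X_iX_j]G = 0` read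
  `α + γt² + t(β + δt²) = 0` and `β + δt² = 0`, so both forms are multiples of `t²X_i² + X_j²` and
  `jetThreeColength a ≥ 5`).

References: G.-M. Greuel, G. Pfister [GreuelPfister2026] (context); H. Hironaka, ms. 2017-03-23
[Hironaka2017] — ROLE only (Th. 16.6 p.84, Th. 16.13 p.87), under adjudication, never as fact.
-/

noncomputable section

-- single-problem summit: the doubled namespace component `ResolutionOfSingularities` is forced
set_option linter.dupNamespace false

open scoped BigOperators Classical

open MvPowerSeries IsLocalRing

open Literature.AlgebraicGeometry.Resolution

namespace Summit.ResolutionOfSingularities.ResolutionOfSingularities.Theorems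

namespace CampaignW46.HypersurfacesCharTwo

open WildCones WildCones.MuDropCharTwoOrdP ThreefoldsCharTwo

variable {κ : Type} [Field κ]

/-! ## Leaf `h₂ = 3`: all partials in `𝔪³` — the transform is singular along the exceptional divisor -/

/-- [OURS · L1 W4.6] **NO TANGENT CUBIC ⇒ NOT ISOLATED** (characteristic two, `n ≥ 2` variables): if
`X_i² G = a∘Φ_{i,τ}` and EVERY partial `∂ₛ a` lies in `𝔪³`, then every partial of `G` is divisible
by `X_i` — the gradient ideal of `G` lies in `(X_i)` and the Milnor algebra of `G` is NOT finite (the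
transform `z² = G` is singular all along the exceptional hyperplane `X_i = 0`). [folklore] -/
theorem not_finite_strict_of_pderiv_mem_cube [CharP κ 2] {n : ℕ} (hn : 2 ≤ n) (i : Fin n)
    (τ : Fin n → κ) {a G : MvPowerSeries (Fin n) κ}
    (hG : X i ^ 2 * G = subst (fun s => if s = i then (X i : MvPowerSeries (Fin n) κ)
      else X i * (X s + C (τ s))) a)
    (h3 : ∀ s, MvPowerSeries.pderiv s a ∈ maximalIdeal (MvPowerSeries (Fin n) κ) ^ 3) :
    ¬ Module.Finite κ (MvPowerSeries (Fin n) κ ⧸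
      Ideal.span (Set.range fun s => MvPowerSeries.pderiv s G)) := by
  -- `X_i³ ∣ (∂ₛ a)∘Φ`
  have hcube : ∀ s, (X i : MvPowerSeries (Fin n) κ) ^ 3 ∣ subst (fun s => if s = i then
      (X i : MvPowerSeries (Fin n) κ) else X i * (X s + C (τ s))) (MvPowerSeries.pderiv s a) :=
    fun s => X_pow_dvd_subst_blowFam i τ
      (Literature.RingTheory.MvPowerSeries.Jets.le_order_of_mem_maximalIdeal_pow (h3 s))
  -- hence `X_i² ∣ ∂ₛ G` for `s ≠ i`
  have hne : ∀ s, s ≠ i → (X i : MvPowerSeries (Fin n) κ) ^ 2 ∣ MvPowerSeries.pderiv s G := by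
    intro s hs
    obtain ⟨w, hw⟩ := hcube s
    rw [← X_mul_pderiv_strict_of_ne i τ hs hG, pow_succ', mul_assoc] at hw
    exact ⟨w, MvPowerSeries.X_mul_cancel hw⟩
  -- and `X_i ∣ ∂ᵢ G`
  have hi : (X i : MvPowerSeries (Fin n) κ) ∣ MvPowerSeries.pderiv i G := by
    have h := X_sq_mul_pderiv_strict_self i τ hG
    have hsum : (X i : MvPowerSeries (Fin n) κ) ^ 3 ∣
        ∑ s ∈ Finset.univ.erase i, (X s + C (τ s)) * (X i * MvPowerSeries.pderiv s G) := by
      refine Finset.dvd_sum fun s hs => ?_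
      obtain ⟨w, hw⟩ := hne s (Finset.ne_of_mem_erase hs)
      exact ⟨(X s + C (τ s)) * w, by rw [hw]; ring⟩
    obtain ⟨w, hw⟩ := (hcube i).add hsum
    rw [← h, show (X i : MvPowerSeries (Fin n) κ) ^ 3 * w = X i ^ 2 * (X i * w) by ring, pow_two,
      mul_assoc, mul_assoc] at hw
    exact ⟨w, MvPowerSeries.X_mul_cancel (MvPowerSeries.X_mul_cancel hw)⟩
  have hle : Ideal.span (Set.range fun s => MvPowerSeries.pderiv s G) ≤
      Ideal.span ((({X i} : Finset (MvPowerSeries (Fin n) κ)) : Set (MvPowerSeries (Fin n) κ))) := by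
    rw [Ideal.span_le, Finset.coe_singleton]
    rintro _ ⟨s, rfl⟩
    by_cases hs : s = i
    · subst hs
      exact Ideal.mem_span_singleton.mpr hi
    · exact Ideal.mem_span_singleton.mpr ((dvd_pow_self _ two_ne_zero).trans (hne s hs))
  refine not_finite_quot_of_le_span _ ?_ (lt_of_lt_of_le (by simp) hn) hle
  intro x hx
  rw [Finset.coe_singleton, Set.mem_singleton_iff] at hx
  subst hx
  exact X_mem_maximalIdeal κ (Fin n) i

/-! ## Two variables `{i, j}`: exponents and the quadratic part of a series in `𝔪²` -/

section TwoVariables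

variable {i j : Fin 2}

/-- `Fin 2 = {i, j}` for `j ≠ i`. [folklore] -/
theorem finTwo_eq_or (hij : j ≠ i) (s : Fin 2) : s = i ∨ s = j := by
  fin_cases i <;> fin_cases j <;> fin_cases s <;> simp_all

/-- An exponent on `Fin 2 = {i, j}` is `(e i)·eᵢ + (e j)·eⱼ`. [folklore] -/
theorem finTwo_eq_single_add (hij : j ≠ i) (e : Fin 2 →₀ ℕ) :
    e = Finsupp.single i (e i) + Finsupp.single j (e j) := by
  ext s
  rcases finTwo_eq_or hij s with rfl | rfl
  · rw [Finsupp.add_apply, Finsupp.single_eq_same, Finsupp.single_eq_of_ne hij.symm, add_zero]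
  · rw [Finsupp.add_apply, Finsupp.single_eq_same, Finsupp.single_eq_of_ne hij, zero_add]

/-- The degree of an exponent on `Fin 2 = {i, j}` is `e i + e j`. [folklore] -/
theorem finTwo_degree (hij : j ≠ i) (e : Fin 2 →₀ ℕ) : e.degree = e i + e j := by
  conv_lhs => rw [finTwo_eq_single_add hij e]
  rw [map_add, Finsupp.degree_single, Finsupp.degree_single]

/-- Exponents on `Fin 2 = {i, j}` are determined by their two values. [folklore] -/
theorem finTwo_eq_pair_iff (hij : j ≠ i) (e : Fin 2 →₀ ℕ) (p q : ℕ) :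
    e = Finsupp.single i p + Finsupp.single j q ↔ e i = p ∧ e j = q := by
  constructor
  · rintro rfl
    rw [Finsupp.add_apply, Finsupp.add_apply, Finsupp.single_eq_same, Finsupp.single_eq_same,
      Finsupp.single_eq_of_ne hij.symm, Finsupp.single_eq_of_ne hij, add_zero, zero_add]
    exact ⟨rfl, rfl⟩
  · rintro ⟨hp, hq⟩
    rw [finTwo_eq_single_add hij e, hp, hq]

/-- Coefficients of the quadratic part `αX_i² + ρX_iX_j + γX_j²`. [folklore] -/
theorem coeff_quadPart (hij : j ≠ i) (α ρ γ : κ) (e : Fin 2 →₀ ℕ) :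
    coeff e (C α * X i ^ 2 + C ρ * (X i * X j) + C γ * X j ^ 2 : MvPowerSeries (Fin 2) κ) =
      (if e i = 2 ∧ e j = 0 then α else 0) + (if e i = 1 ∧ e j = 1 then ρ else 0) +
      (if e i = 0 ∧ e j = 2 then γ else 0) := by
  have hXX : (X i * X j : MvPowerSeries (Fin 2) κ) =
      monomial (Finsupp.single i 1 + Finsupp.single j 1) 1 := by
    rw [X_def, X_def, monomial_mul_monomial, one_mul]
  have h1 : (e = Finsupp.single i 2) ↔ (e i = 2 ∧ e j = 0) := by
    rw [← finTwo_eq_pair_iff hij e 2 0, Finsupp.single_zero, add_zero]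
  have h2 : (e = Finsupp.single i 1 + Finsupp.single j 1) ↔ (e i = 1 ∧ e j = 1) :=
    finTwo_eq_pair_iff hij e 1 1
  have h3 : (e = Finsupp.single j 2) ↔ (e i = 0 ∧ e j = 2) := by
    rw [← finTwo_eq_pair_iff hij e 0 2, Finsupp.single_zero, zero_add]
  rw [map_add, map_add, coeff_C_mul, coeff_C_mul, coeff_C_mul, coeff_X_pow, coeff_X_pow, hXX,
    coeff_monomial]
  by_cases c1 : e i = 2 ∧ e j = 0
  · rw [if_pos (h1.mpr c1), if_pos c1, if_neg (fun H => by rw [h2] at H; omega),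
      if_neg (fun H : e i = 1 ∧ e j = 1 => by omega), if_neg (fun H => by rw [h3] at H; omega),
      if_neg (fun H : e i = 0 ∧ e j = 2 => by omega)]
    ring
  · rw [if_neg (fun H => c1 (h1.mp H)), if_neg c1]
    by_cases c2 : e i = 1 ∧ e j = 1
    · rw [if_pos (h2.mpr c2), if_pos c2, if_neg (fun H => by rw [h3] at H; omega),
        if_neg (fun H : e i = 0 ∧ e j = 2 => by omega)]
      ring
    · rw [if_neg (fun H => c2 (h2.mp H)), if_neg c2]
      by_cases c3 : e i = 0 ∧ e j = 2
      · rw [if_pos (h3.mpr c3), if_pos c3]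
        ring
      · rw [if_neg (fun H => c3 (h3.mp H)), if_neg c3]
        ring

/-- A series in `𝔪²` minus its quadratic part lies in `𝔪³` (two variables `{i, j}`). [folklore] -/
theorem sub_quadPart_mem_cube (hij : j ≠ i) {h : MvPowerSeries (Fin 2) κ}
    (hh : h ∈ maximalIdeal (MvPowerSeries (Fin 2) κ) ^ 2) :
    h - (C (coeff (Finsupp.single i 2) h) * X i ^ 2 +
      C (coeff (Finsupp.single i 1 + Finsupp.single j 1) h) * (X i * X j) +
      C (coeff (Finsupp.single j 2) h) * X j ^ 2) ∈ maximalIdeal (MvPowerSeries (Fin 2) κ) ^ 3 := by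
  refine Literature.RingTheory.MvPowerSeries.Jets.mem_maximalIdeal_pow_of_coeff_eq_zero
    fun e he => ?_
  rw [map_sub, coeff_quadPart hij, sub_eq_zero]
  rw [finTwo_degree hij] at he
  by_cases h2 : e i + e j < 2
  · -- degree `< 2`: everything vanishes
    have hc : coeff e h = 0 :=
      Literature.RingTheory.MvPowerSeries.Jets.coeff_eq_zero_of_mem_maximalIdeal_pow hh
        (by rw [finTwo_degree hij]; exact h2)
    rw [hc, if_neg (fun H => by omega), if_neg (fun H => by omega), if_neg (fun H => by omega),
      add_zero, add_zero]
  · -- degree `= 2`: the three monomials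
    have hcases : (e i = 2 ∧ e j = 0) ∨ (e i = 1 ∧ e j = 1) ∨ (e i = 0 ∧ e j = 2) := by omega
    rcases hcases with ⟨h1, h2'⟩ | ⟨h1, h2'⟩ | ⟨h1, h2'⟩
    · rw [if_pos ⟨h1, h2'⟩, if_neg (fun H => by omega), if_neg (fun H => by omega), add_zero,
        add_zero, show e = Finsupp.single i 2 by
          rw [finTwo_eq_single_add hij e, h1, h2', Finsupp.single_zero, add_zero]]
    · rw [if_neg (fun H => by omega), if_pos ⟨h1, h2'⟩, if_neg (fun H => by omega), zero_add,
        add_zero, show e = Finsupp.single i 1 + Finsupp.single j 1 by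
          rw [finTwo_eq_single_add hij e, h1, h2']]
    · rw [if_neg (fun H => by omega), if_neg (fun H => by omega), if_pos ⟨h1, h2'⟩, zero_add,
        zero_add, show e = Finsupp.single j 2 by
          rw [finTwo_eq_single_add hij e, h1, h2', Finsupp.single_zero, zero_add]]

/-- `[X_i²] (X_i² · F) = F(0)`. [folklore] -/
theorem coeff_sq_X_sq_mul (F : MvPowerSeries (Fin 2) κ) :
    coeff (Finsupp.single i 2) (X i ^ 2 * F) = constantCoeff F := by
  rw [show (Finsupp.single i 2 : Fin 2 →₀ ℕ) = Finsupp.single i 1 + (Finsupp.single i 1 + 0) by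
    rw [add_zero, ← Finsupp.single_add], pow_two, mul_assoc, coeff_single_add_X_mul,
    coeff_single_add_X_mul, coeff_zero_eq_constantCoeff_apply]

/-- `[X_i²] (X_i · F) = [X_i] F`. [folklore] -/
theorem coeff_sq_X_mul (F : MvPowerSeries (Fin 2) κ) :
    coeff (Finsupp.single i 2) (X i * F) = coeff (Finsupp.single i 1) F := by
  rw [show (Finsupp.single i 2 : Fin 2 →₀ ℕ) = Finsupp.single i 1 + Finsupp.single i 1 by
    rw [← Finsupp.single_add], coeff_single_add_X_mul]

/-- `[X_i²] (X_j · F) = 0` (`j ≠ i`). [folklore] -/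
theorem coeff_sq_X_mul_of_ne (hij : j ≠ i) (F : MvPowerSeries (Fin 2) κ) :
    coeff (Finsupp.single i 2) (X j * F) = 0 := by
  rw [X_def, coeff_monomial_mul, if_neg]
  rw [Finsupp.single_le_iff, Finsupp.single_eq_of_ne hij]
  omega

/-- **THE `X_i²`-COEFFICIENT AFTER THE BLOW-UP** (two variables `{i, j}`, slope `t = τ j`): for
`h ∈ 𝔪²`, `[X_i²](h∘Φ_{i,τ}) = [X_i²]h + t [X_iX_j]h + t² [X_j²]h` — the quadratic form of `h`
evaluated at the direction `(1 : t)`. [folklore] -/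
theorem coeff_sq_subst_blowFam (hij : j ≠ i) (τ : Fin 2 → κ) {h : MvPowerSeries (Fin 2) κ}
    (hh : h ∈ maximalIdeal (MvPowerSeries (Fin 2) κ) ^ 2) :
    coeff (Finsupp.single i 2) (subst (fun s => if s = i then (X i : MvPowerSeries (Fin 2) κ)
      else X i * (X s + C (τ s))) h) =
      coeff (Finsupp.single i 2) h + τ j * coeff (Finsupp.single i 1 + Finsupp.single j 1) h +
        τ j ^ 2 * coeff (Finsupp.single j 2) h := by
  have hΦ := hasSubst_blowFam (κ := κ) i τ
  set Q : MvPowerSeries (Fin 2) κ := C (coeff (Finsupp.single i 2) h) * X i ^ 2 +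
      C (coeff (Finsupp.single i 1 + Finsupp.single j 1) h) * (X i * X j) +
      C (coeff (Finsupp.single j 2) h) * X j ^ 2 with hQdef
  set r := h - Q with hr
  have hsplit : h = Q + r := by rw [hr]; ring
  have hr3 : (3 : ℕ∞) ≤ r.order :=
    Literature.RingTheory.MvPowerSeries.Jets.le_order_of_mem_maximalIdeal_pow
      (sub_quadPart_mem_cube hij hh)
  have hr0 : coeff (Finsupp.single i 2) (subst (fun s => if s = i then
      (X i : MvPowerSeries (Fin 2) κ) else X i * (X s + C (τ s))) r) = 0 :=
    X_pow_dvd_iff.mp (X_pow_dvd_subst_blowFam i τ (d := 3) hr3) (Finsupp.single i 2)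
      (by rw [Finsupp.single_eq_same]; norm_num)
  have hXi : subst (fun s => if s = i then (X i : MvPowerSeries (Fin 2) κ)
      else X i * (X s + C (τ s))) (X i : MvPowerSeries (Fin 2) κ) = X i := by
    rw [subst_X hΦ, if_pos rfl]
  have hXj : subst (fun s => if s = i then (X i : MvPowerSeries (Fin 2) κ)
      else X i * (X s + C (τ s))) (X j : MvPowerSeries (Fin 2) κ) = X i * (X j + C (τ j)) := by
    rw [subst_X hΦ, if_neg hij]
  -- the quadratic part after the blow-up is `X_i² · F`
  have hQ : subst (fun s => if s = i then (X i : MvPowerSeries (Fin 2) κ)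
      else X i * (X s + C (τ s))) Q =
      X i ^ 2 * (C (coeff (Finsupp.single i 2) h) +
        C (coeff (Finsupp.single i 1 + Finsupp.single j 1) h) * (X j + C (τ j)) +
        C (coeff (Finsupp.single j 2) h) * (X j + C (τ j)) ^ 2) := by
    rw [hQdef]
    simp only [subst_add hΦ, subst_mul hΦ, subst_pow hΦ, subst_C, hXi, hXj]
    ring
  have key : subst (fun s => if s = i then (X i : MvPowerSeries (Fin 2) κ)
      else X i * (X s + C (τ s))) h = subst (fun s => if s = i then (X i : MvPowerSeries (Fin 2) κ)
      else X i * (X s + C (τ s))) Q + subst (fun s => if s = i then (X i : MvPowerSeries (Fin 2) κ)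
      else X i * (X s + C (τ s))) r := by
    rw [← subst_add hΦ, ← hsplit]
  rw [key, map_add, hr0, add_zero, hQ, coeff_sq_X_sq_mul]
  simp only [map_add, map_mul, map_pow, constantCoeff_C, constantCoeff_X, zero_add]
  ring

/-- In two variables and characteristic two the partials have no `X_iX_j`-term:
`[X_iX_j] ∂ₛ a = 2·[X_iX_jX_s] a = 0`. [folklore] -/
theorem coeff_pair_pderiv_eq_zero [CharP κ 2] (hij : j ≠ i) (s : Fin 2)
    (a : MvPowerSeries (Fin 2) κ) :
    coeff (Finsupp.single i 1 + Finsupp.single j 1) (MvPowerSeries.pderiv s a) = 0 := by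
  rw [MvPowerSeries.coeff_pderiv]
  have h1 : ((Finsupp.single i 1 + Finsupp.single j 1 : Fin 2 →₀ ℕ) s : κ) + 1 = 0 := by
    rcases finTwo_eq_or hij s with rfl | rfl
    · rw [Finsupp.add_apply, Finsupp.single_eq_same, Finsupp.single_eq_of_ne hij.symm, add_zero,
        Nat.cast_one, CharTwo.add_self_eq_zero]
    · rw [Finsupp.add_apply, Finsupp.single_eq_same, Finsupp.single_eq_of_ne hij, zero_add,
        Nat.cast_one, CharTwo.add_self_eq_zero]
  rw [h1, zero_mul]

/-! ## Leaf `h₂ = 1`: three distinct tangents force a hyperbolic pair in the strict transform -/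

/-- [OURS · L1 W4.6] **THREE TANGENTS ⇒ A NEW HYPERBOLIC PAIR** (two variables, characteristic two):
let `X_i² G = a∘Φ_{i,τ}` with `a ∈ κ⟦X_i, X_j⟧` of order `≥ 2` without `X_iX_j`-term and `G`
without linear terms. If `jetThreeColength a ≤ 4` (the two diagonal quadratic forms `(∂ᵢa)₂`,
`(∂ⱼa)₂` are linearly independent — the tangent cubic of the plane germ has three distinct roots)
then `[X_iX_j] G ≠ 0`: the successor has a hyperbolic pair. Indeed `[X_i]G = 0` and `[X_iX_j]G = 0`
read `α + γt² + t(β + δt²) = 0`, `β + δt² = 0` for `(∂ᵢa)₂ = αX_i² + γX_j²`, `(∂ⱼa)₂ = βX_i² +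
δX_j²`, `t = τ j`; then both forms are multiples of `t²X_i² + X_j²` and `jetThreeColength a ≥ 5`
(`five_le_jetThreeColength`). [folklore] -/
theorem coeff_pair_strict_ne_zero_of_jetThreeColength_le_four [CharP κ 2] (hij : j ≠ i)
    (τ : Fin 2 → κ) {a G : MvPowerSeries (Fin 2) κ} (ha : 2 ≤ a.order)
    (hnopair : ∀ s t : Fin 2, s ≠ t → coeff (Finsupp.single s 1 + Finsupp.single t 1) a = 0)
    (hG0 : ∀ s, coeff (Finsupp.single s 1) G = 0)
    (hG : X i ^ 2 * G = subst (fun s => if s = i then (X i : MvPowerSeries (Fin 2) κ)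
      else X i * (X s + C (τ s))) a)
    (h4 : jetThreeColength a ≤ 4) :
    coeff (Finsupp.single i 1 + Finsupp.single j 1) G ≠ 0 := by
  intro hq
  have ha' := (FormalCoordChange.two_le_order_iff a).mp ha
  have hmem : ∀ s, MvPowerSeries.pderiv s a ∈ maximalIdeal (MvPowerSeries (Fin 2) κ) ^ 2 :=
    pderiv_mem_maximalIdeal_sq ha'.2 hnopair
  have hρf : coeff (Finsupp.single i 1 + Finsupp.single j 1) (MvPowerSeries.pderiv i a) = 0 :=
    coeff_pair_pderiv_eq_zero hij i a
  have hρg : coeff (Finsupp.single i 1 + Finsupp.single j 1) (MvPowerSeries.pderiv j a) = 0 :=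
    coeff_pair_pderiv_eq_zero hij j a
  have huniv : Finset.univ.erase i = ({j} : Finset (Fin 2)) := by
    ext s
    rcases finTwo_eq_or hij s with rfl | rfl
    · simp [hij.symm]
    · simp [hij]
  -- (E1): `[X_iX_j] G = β + t² δ = 0`
  have hE1 : coeff (Finsupp.single i 2) (MvPowerSeries.pderiv j a) +
      τ j ^ 2 * coeff (Finsupp.single j 2) (MvPowerSeries.pderiv j a) = 0 := by
    have h := congrArg (coeff (Finsupp.single i 2)) (X_mul_pderiv_strict_of_ne i τ hij hG)
    rw [coeff_sq_X_mul, coeff_single_pderiv, coeff_sq_subst_blowFam hij τ (hmem j), hρg, mul_zero,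
      add_zero, Finsupp.single_eq_of_ne hij, Nat.cast_zero, zero_add, one_mul, hq] at h
    exact h.symm
  -- (E2): `[X_i] G = (α + t² γ) + t (β + t² δ) = 0`, so `α + t² γ = 0`
  have hE2 : coeff (Finsupp.single i 2) (MvPowerSeries.pderiv i a) +
      τ j ^ 2 * coeff (Finsupp.single j 2) (MvPowerSeries.pderiv i a) = 0 := by
    have h := congrArg (coeff (Finsupp.single i 2)) (X_sq_mul_pderiv_strict_self i τ hG)
    rw [coeff_sq_X_sq_mul, constantCoeff_pderiv, hG0 i, huniv, Finset.sum_singleton,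
      X_mul_pderiv_strict_of_ne i τ hij hG, map_add, coeff_sq_subst_blowFam hij τ (hmem i), hρf,
      mul_zero, add_zero, add_mul, map_add, coeff_sq_X_mul_of_ne hij, zero_add, coeff_C_mul,
      coeff_sq_subst_blowFam hij τ (hmem j), hρg, mul_zero, add_zero, hE1, mul_zero, add_zero] at h
    exact h.symm
  -- in characteristic two `x + t² y = 0` means `x = t² y`
  have hβ := add_eq_zero_iff_eq_neg.mp hE1
  have hα := add_eq_zero_iff_eq_neg.mp hE2
  rw [CharTwo.neg_eq] at hα hβ
  -- both quadratic parts are multiples of `q = t² X_i² + X_j²`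
  set q : MvPowerSeries (Fin 2) κ := C (τ j ^ 2) * X i ^ 2 + X j ^ 2 with hqdef
  have hsq : ∀ s : Fin 2, (X s : MvPowerSeries (Fin 2) κ) ^ 2 ∈
      maximalIdeal (MvPowerSeries (Fin 2) κ) ^ 2 := fun s =>
    Ideal.pow_mem_pow (X_mem_maximalIdeal κ (Fin 2) s) 2
  have hq2 : q ∈ maximalIdeal (MvPowerSeries (Fin 2) κ) ^ 2 :=
    Ideal.add_mem _ (Ideal.mul_mem_left _ _ (hsq i)) (hsq j)
  have hmul : ∀ (h : MvPowerSeries (Fin 2) κ) (c : κ),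
      h ∈ maximalIdeal (MvPowerSeries (Fin 2) κ) ^ 2 →
      coeff (Finsupp.single i 2) h = τ j ^ 2 * c →
      coeff (Finsupp.single i 1 + Finsupp.single j 1) h = 0 →
      coeff (Finsupp.single j 2) h = c →
      h ∈ Ideal.span {q} ⊔ maximalIdeal (MvPowerSeries (Fin 2) κ) ^ 3 := by
    intro h c hh hi hij2 hj
    have hr := sub_quadPart_mem_cube hij hh
    rw [hi, hij2, hj] at hr
    have hdec : h = C c * q +
        (h - (C (τ j ^ 2 * c) * X i ^ 2 + C 0 * (X i * X j) + C c * X j ^ 2)) := by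
      rw [hqdef, map_mul, map_zero]; ring
    rw [hdec]
    exact Submodule.add_mem_sup (Ideal.mul_mem_left _ _ (Ideal.mem_span_singleton_self q)) hr
  have hfq := hmul (MvPowerSeries.pderiv i a) _ (hmem i) hα hρf rfl
  have hgq := hmul (MvPowerSeries.pderiv j a) _ (hmem j) hβ hρg rfl
  have h5 := five_le_jetThreeColength (f := a) hq2 fun s => by
    rcases finTwo_eq_or hij s with rfl | rfl
    · exact hfq
    · exact hgq
  omega

end TwoVariables

end CampaignW46.HypersurfacesCharTwo

end Summit.ResolutionOfSingularities.ResolutionOfSingularities.Theorems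

end
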